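import Summits.QuantumFields.YangMills.Theorems.BalabanUVNodesN08AlphaEq324RowRange
import Summits.QuantumFields.YangMills.Theorems.BalabanUVNodesN08AlphaEq324RowCoreZero
import Summits.QuantumFields.YangMills.Theorems.BalabanUVNodesN08AlphaFarCurrency

/-!
# Route «BalabanUVNodes», Track-A DAG node N08 = [Balaban1985UV3] Thm 1 p. 257 ∕ Thm 2 p. 272 — THE RANGE-HONEST BUNDLE IS INHABITED FOR EVERY RECORD:
# the zero auxiliary data `zeroAlphaLT` of `…Eq324RowRange.AlphaDataLT` at dag-n08-d's zero series needs NO sign hypothesis `hfar` (the run's steps have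
# `g_k ≤ 1`), whereas the lane's `AlphaData` is EMPTY for `r₀ = 2` (`…N08AlphaFarCurrency.isEmpty_alphaData_of_r₀_eq_two`); and the range-honest core
# clause at zero data = residual pair ∧ class-I rows, as before

Cell `pub-ymgap`, seat `pub-ymgap-dag-n08-w4` gen 0 (INTENT-5 part 2; sequel of `…Eq324RowRange`, `…Eq324RowCoreZero`, dag-n08-d's `…N08AlphaFarCurrency` ∕
`…ZeroData(Rows)`).  `bears_on: R4∕N08`; filed `--supports stmt-QuantumFields-20542` (K1⁷).  One `def` (the zero bundle) + theorems; sorry-free; standard axioms.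

WHAT THIS FILE PROVES (zero series `zeroRun 𝔊 𝔠`, ANY external inputs `X`; the ONLY hypothesis is the family condition `S.g²·S.ε₀ ≤ 1`, i.e. `g_k ≤ 1` on the
run — NO `hfar`, NO sign of `Ca`∕`Cc`, ANY `r₀`):
* `zeroAlphaLT hle : AlphaDataLT 𝔊 𝔠 X (zeroRun 𝔊 𝔠)` — dag-n08-d's zero (63)-localisation `zeroLocalized` at every RUN step (its sign input supplied by
  `farCurrency_nonneg_of_le_one`), G3D-08 with the record's `C45`, `cP ≡ 0`, zero G3D-02 constants; ★ `nonempty_alphaDataLT_zeroRun` — for EVERY record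
  (contrast: `isEmpty_alphaData_of_r₀_eq_two` for the lane's bundle) ⇒ dag-n08-d's located typing looseness 13C is RESOLVED by the range-honest typing:
  `not_isEmpty_alphaDataLT_zeroRun`.
* ★ `stepAlphaEq324CoreLT_zero_iff` ∕ ★ `runAlphaEq324CoreLT_zero_iff` — at `zeroAlphaLT hle` the range-honest core clause holds IFF the residual pair (per run
  step) and the class-I rows hold — the zero-data reading of `…RowCoreZero` carried to the range-honest bundle; hence `runAlphaEq324CoreLT_zero_of_pairs`:
  an INHABITANT of the END theorem's hypothesis `RunAlphaEq324CoreLT` at every record and lattice approximation, modulo the residual pair and the class-I rows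
  about the external inputs — exactly the lane's A6 status, now uniform in the record.
HONEST FRAMING: count-neutral typing facts; the zero series is test data, not Bałaban's expansion; nothing of [B10] asserted; N08 NOT discharged; d = 3 tori
inside the record; nothing about d = 4, the continuum, OS axioms, a mass gap or Clay — R4 closes the conditional finite-𝕋⁴ rung `BalabanLadder.UV` only.
-/

noncomputable section

namespace Summit.QuantumFields.YangMills.Theorems.BalabanUVNodesN08AlphaEq324RowRangeZero

open MeasureTheory ProbabilityTheory Metric
open scoped BigOperators Matrix
open Literature.MathematicalPhysics.QuantumFieldTheory.Balaban1983to89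
open Literature.MathematicalPhysics.QuantumFieldTheory.Balaban1983to89.B10
open Literature.MathematicalPhysics.QuantumFieldTheory.Balaban1983to89.B10SectCExpansion (Shape43 Bound44 TermSizes)
open Literature.MathematicalPhysics.QuantumFieldTheory.Balaban1983to89.TreeLengthTorus (tsys)
open Literature.MathematicalPhysics.QuantumFieldTheory.Balaban1983to89.B1Sect3Statements (Eq324)
open Literature.MathematicalPhysics.QuantumFieldTheory.Balaban1985CMP102
open Literature.MathematicalPhysics.QuantumFieldTheory.Balaban1985CMP102.Setting
open Literature.MathematicalPhysics.QuantumFieldTheory.Balaban1985CMP102.Binders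
open Literature.MathematicalPhysics.QuantumFieldTheory.Balaban1985CMP102.BindersNewborn (NewbornTerms45AsCited)
open Summit.QuantumFields.Balaban3D.Carriers
open Summit.QuantumFields.Balaban3D.Proofs.Inputs
open Summit.QuantumFields.Balaban3D.Proofs.Primitives (AlphaConsts)
open Summit.QuantumFields.Balaban3D.Proofs.GroupModelLieC (lieC)
open Summit.QuantumFields.Balaban3D.Proofs.UVStability3DInputs
open Summit.QuantumFields.Balaban3D.Proofs.Representation33 (jet26 jet26_apply_zero)
open Summit.QuantumFields.Balaban3D.Proofs.Bound55Std (Fibre49 Fibre57Low)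
open Summit.QuantumFields.Balaban3D.Proofs.ScalesArithmetic (gk_pos gk_le_one sites_nonneg g0sq_pos)
open Summit.QuantumFields.Balaban3D.Proofs.VacuumAndBooking (rFun_nonneg)
open Summit.QuantumFields.YangMills.Theorems.BalabanUVNodesN08AlphaClassI
open Summit.QuantumFields.YangMills.Theorems.BalabanUVNodesN08AlphaZeroData
open Summit.QuantumFields.YangMills.Theorems.BalabanUVNodesN08AlphaZeroDataRows
open Summit.QuantumFields.YangMills.Theorems.BalabanUVNodesN08AlphaFarCurrency (isEmpty_alphaData_of_r₀_eq_two)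
open Summit.QuantumFields.YangMills.Theorems.BalabanUVNodesN08AlphaEq324RowCore
open Summit.QuantumFields.YangMills.Theorems.BalabanUVNodesN08AlphaEq324RowRange

variable {L : ℕ}

section Zero

variable {S : Scales L} {G : Type} [GaugeGroup G] [MeasurableSpace G] [HaarData G] (𝔊 : GroupModel G) (𝔠 : AlphaConsts L 𝔊.N)
  (X : ExternalInputs S G)

/-- **THE ZERO RANGE-HONEST BUNDLE** at the zero series, on a family member `g²ε₀ ≤ 1`: dag-n08-d's zero (63)-localisation at every RUN step `k < K` (its
G3D-06 sign input is AUTOMATIC there: `g_k ≤ 1`, `farCurrency_nonneg_of_le_one`), G3D-08 with the record's `C45` (the jet of the zero piece vanishes),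
`cP ≡ 0`, zero G3D-02 constants.  No `hfar`, any `r₀`. [folklore] -/
def zeroAlphaLT (hle : S.g ^ 2 * S.ε₀ ≤ 1) : AlphaDataLT 𝔊 𝔠 X (zeroRun 𝔊 𝔠) where
  Λc k hk := zeroLocalized 𝔊 𝔠 X k (farCurrency_nonneg_of_le_one 𝔊 𝔠 (gk_le_one S hle k (by omega)))
  N45 k hk :=
    { C45_nonneg := 𝔠.C45_nonneg
      jet45 := fun Y h U => by
        have h0 : (∑ n ∈ Finset.Ico 2 7, ((n.factorial : ℂ)⁻¹ •
            iteratedFDeriv ℂ n ((zeroLocalized 𝔊 𝔠 X k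
              (farCurrency_nonneg_of_le_one 𝔊 𝔠 (gk_le_one S hle k (by omega)))).Ψ Y) 0
              fun _ => ((zeroRun 𝔊 𝔠) k).Bcfg Y h U)) = 0 := by
          show jet26 (fun _ : ((zeroRun 𝔊 𝔠) k).E => (0 : ℂ)) (0 : ((zeroRun 𝔊 𝔠) k).E) = 0
          exact jet26_apply_zero _
        rw [h0]
        show |(0 : ℂ).re - 0| ≤ _
        rw [Complex.zero_re, sub_zero, abs_zero]
        exact mul_nonneg (mul_nonneg 𝔠.C45_nonneg (sq_nonneg _)) (mul_nonneg 𝔠.C63_nonneg (Real.exp_pos _).le) }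
  cP := fun _ => 0
  C₂₃ := fun _ => 0
  c₂₃ := fun _ => 0
  M₂₃ := fun _ => 0
  δ₀ := fun _ => 0

/-- ★ **THE RANGE-HONEST BUNDLE IS INHABITED FOR EVERY RECORD** at the zero series of every family member — ANY `r₀`, any amplitudes `Cfar, C63`.
[cite: Balaban1985UV3, (7) p.257 + (63) p.272 (bookkeeping over the typed bundle)] -/
theorem nonempty_alphaDataLT_zeroRun (hle : S.g ^ 2 * S.ε₀ ≤ 1) : Nonempty (AlphaDataLT 𝔊 𝔠 X (zeroRun 𝔊 𝔠)) :=
  ⟨zeroAlphaLT 𝔊 𝔠 X hle⟩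

/-- **CONTRAST, side by side** (dag-n08-d's located 13C resolved by the range-honest typing): for a record with `r₀ = 2` and `Cfar, C63 > 0` the lane's bundle
`AlphaData` at the zero series is EMPTY while the range-honest bundle is NOT. [cite: Balaban1985UV3, (7) p.257 + p.264 L14–20 (bookkeeping)] -/
theorem isEmpty_alphaData_and_nonempty_alphaDataLT (hCfar : 0 < 𝔠.Cfar) (hC63 : 0 < 𝔠.C63) (hr : 𝔠.r₀ = 2) (hle : S.g ^ 2 * S.ε₀ ≤ 1) :
    IsEmpty (AlphaData 𝔊 𝔠 X (zeroRun 𝔊 𝔠)) ∧ Nonempty (AlphaDataLT 𝔊 𝔠 X (zeroRun 𝔊 𝔠)) :=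
  ⟨isEmpty_alphaData_of_r₀_eq_two 𝔊 𝔠 X (zeroRun 𝔊 𝔠) hCfar hC63 hr, nonempty_alphaDataLT_zeroRun 𝔊 𝔠 X hle⟩

/-- Field of the zero range-honest localisation (`rfl`). [folklore] -/
@[simp] theorem zeroAlphaLT_Λc_Ψ (hle : S.g ^ 2 * S.ε₀ ≤ 1) (k : ℕ) (hk : k + 1 ≤ S.K) (Y : (tsys 3 (nblkOf S 𝔠.lane.carrier k)).Dom)
    (b : ((zeroRun 𝔊 𝔠) k).E) : ((zeroAlphaLT 𝔊 𝔠 X hle).Λc k hk).Ψ Y b = 0 := rfl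

/-- Field of the zero range-honest localisation (`rfl`). [folklore] -/
@[simp] theorem zeroAlphaLT_Λc_far (hle : S.g ^ 2 * S.ε₀ ≤ 1) (k : ℕ) (hk : k + 1 ≤ S.K) (Y : (tsys 3 (nblkOf S 𝔠.lane.carrier k)).Dom)
    (h : Hist S.P (k + 1)) (U : GaugeField S.P (k + 1) G) : ((zeroAlphaLT 𝔊 𝔠 X hle).Λc k hk).far Y h U = 0 := rfl

open Classical in
/-- ★ **THE RANGE-HONEST CORE STEP LIST AT ZERO DATA IS «RESIDUAL PAIR ∧ MEASURABLE MINIMISERS»** (the reading of `…RowCoreZero.stepAlphaEq324Core_zero_iff`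
at the zero range-honest bundle; NO `hfar`, NO sign of `Ca`∕`Cc`). [cite: Balaban1985UV3, (41) p.266 + (55)–(63) pp.269–272; Balaban1982Higgs1, (3.24) p.616] -/
theorem stepAlphaEq324CoreLT_zero_iff (hle : S.g ^ 2 * S.ε₀ ≤ 1) {k : ℕ} (hk : k + 1 ≤ S.K) :
    StepAlphaEq324CoreLT 𝔊 𝔠 X (zeroRun 𝔊 𝔠) (zeroAlphaLT 𝔊 𝔠 X hle) k hk ↔
      ((∀ h' : Hist S.P (k + 1),
          Fibre49 X 𝔠.lane.carrier (zeroRun 𝔊 𝔠) (fun _ => True) k (piecesW 𝔠.lane X (zeroRun 𝔊 𝔠) k) h') ∧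
        Fibre57Low X 𝔠.lane.carrier (zeroRun 𝔊 𝔠) (fun _ => True) k (piecesW 𝔠.lane X (zeroRun 𝔊 𝔠) k)) ∧
      ∀ h : Hist S.P k, Measurable (X.UkH k h) := by
  refine ⟨fun A => ⟨⟨A.fibre49, A.fibre57Low⟩, A.hU⟩, fun H => ?_⟩
  have hg1 : S.gk k ≤ 1 := gk_le_one S hle k (by omega)
  have hg : 0 < S.gk k := gk_pos S k
  have hrp := rFun_mul_pFun_nonneg 𝔠 hg1
  -- every row except `hPYZ`, `hG`, `hPb` is read off the `…RowCoreZero` zero-data instance at dag-n08-d's `zeroAlpha` (same step series)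
  have hfar : ∀ k, 0 ≤ 𝔠.Cfar * (𝔠.C63 * (S.gk k ^ 7 * (rFun 𝔠.r₀ (S.gk k) * pFun 𝔠.b₀ 𝔠.p₀ (S.gk k)) ^ 7)) →
      0 ≤ 𝔠.Cfar * (𝔠.C63 * (S.gk k ^ 7 * (rFun 𝔠.r₀ (S.gk k) * pFun 𝔠.b₀ 𝔠.p₀ (S.gk k)) ^ 7)) := fun _ h => h
  have hI := (stepRowsI_zero_iff 𝔊 𝔠 X hg1).2 H.2
  have hrem : 0 ≤ (𝔠.Ca + 𝔠.Cc) * ((L : ℝ) ^ k * S.g0sq) ^ (3 + 𝔠.κ₀) * S.sites k :=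
    mul_nonneg (mul_nonneg 𝔠.Cac_nonneg (Real.rpow_nonneg (mul_nonneg (pow_nonneg (Nat.cast_nonneg _) _)
      (g0sq_pos S).le) _)) (sites_nonneg S k)
  exact
    { chart := fun Y => ⟨𝔠.ρ_pos, differentiableOn_const _, fun z _ => by
        show ‖(0 : ℂ)‖ ≤ _
        rw [norm_zero]
        exact mul_nonneg (mul_nonneg 𝔠.C25_nonneg hg.le) (Real.exp_pos _).le⟩
      bound28 := fun Y h U => by
        show ‖(0 : PBond S.P k → ↥(lieC 𝔊))‖ ≤ _
        rw [norm_zero]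
        exact mul_nonneg 𝔠.cB_nonneg (mul_nonneg (mul_nonneg (rFun_nonneg 𝔠.r₀ _ hg hg1) hg.le)
          (pFun_nonneg 𝔠.b₀ 𝔠.p₀ (S.gk k) 𝔠.b₀_pos.le hg hg1))
      inv26 := fun _ _ _ _ _ => rfl
      far_le := fun Y h U => by
        show |(0 : ℝ)| ≤ _
        rw [abs_zero]
        exact mul_nonneg 𝔠.Cfar_nonneg (mul_nonneg (mul_nonneg (mul_nonneg 𝔠.C25_nonneg hg.le) (Real.exp_pos _).le)
          (mul_nonneg (pow_nonneg hg.le _) (pow_nonneg hrp _)))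
      hPY := fun h U => by simp [jet26_apply_zero]
      hPYZ := fun h U => by simp [jet26_apply_zero]
      norm35 := fun h => ⟨zeroNorm35Model 𝔊 𝔠 X k h⟩
      logZT := ⟨zeroLogZTModel 𝔊 𝔠 X k⟩
      hact := fun h Y U => by
        rw [zeroSeries_act]
        exact zeroGraphTerms_act Y U
      hG := fun h =>
        ⟨fun U => by simp, fun γ hγ => by simp at hγ, fun γ hγ => by simp at hγ, fun γ hγ => by simp at hγ⟩
      h324 := fun h U => by
        refine ⟨0, by rw [abs_zero]; exact hrem, ?_⟩
        show ∫ _ω in (Set.univ : Set Unit), Real.exp 0 ∂(Measure.dirac ()) = _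
        simp
      h44 := hI.h44
      hfloor := hI.hfloor
      hU := H.2
      hPm := fun h => by
        have : (inputOf 𝔠.lane X (zeroRun 𝔊 𝔠)).Pint k h = fun _ => 0 := funext (inputOf_zeroRun_Pint 𝔊 𝔠 X k h)
        rw [this]
        exact measurable_const
      hPb := fun h U => by
        rw [inputOf_zeroRun_Pint]
        exact le_rfl
      fibre49 := H.1.1
      fibre57Low := H.1.2 }

/-- ★ **THE RANGE-HONEST CORE RUN CLAUSE AT ZERO DATA = RESIDUAL PAIRS + THE CLASS-I ROWS**, for EVERY record (no `hfar`, no sign of `Ca`∕`Cc`).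
[cite: Balaban1985UV3, (41) p.266 + (47) p.267 + (67)–(68) p.273] -/
theorem runAlphaEq324CoreLT_zero_iff (hle : S.g ^ 2 * S.ε₀ ≤ 1) :
    RunAlphaEq324CoreLT 𝔊 𝔠 X (zeroRun 𝔊 𝔠) (zeroAlphaLT 𝔊 𝔠 X hle) ↔
      (∀ k, k + 1 ≤ S.K →
        (∀ h' : Hist S.P (k + 1),
            Fibre49 X 𝔠.lane.carrier (zeroRun 𝔊 𝔠) (fun _ => True) k (piecesW 𝔠.lane X (zeroRun 𝔊 𝔠) k) h') ∧
          Fibre57Low X 𝔠.lane.carrier (zeroRun 𝔊 𝔠) (fun _ => True) k (piecesW 𝔠.lane X (zeroRun 𝔊 𝔠) k)) ∧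
      RunRowsI 𝔊 𝔠 X (zeroRun 𝔊 𝔠) := by
  constructor
  · intro R
    refine ⟨fun k hk => ((stepAlphaEq324CoreLT_zero_iff 𝔊 𝔠 X hle hk).1 (R.steps k hk)).1, ⟨fun k hk => ?_, R.hLF67, R.h68⟩⟩
    exact (stepRowsI_zero_iff 𝔊 𝔠 X (gk_le_one S hle k (by omega))).2
      ((stepAlphaEq324CoreLT_zero_iff 𝔊 𝔠 X hle hk).1 (R.steps k hk)).2
  · rintro ⟨H, I⟩
    exact ⟨fun k hk => (stepAlphaEq324CoreLT_zero_iff 𝔊 𝔠 X hle hk).2 ⟨H k hk, (I.steps k hk).hU⟩, I.hLF67, I.h68⟩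

/-- **AN INHABITANT OF THE END THEOREM'S HYPOTHESIS FOR EVERY RECORD, modulo the residual pair and the class-I rows** (A6 status of
`…Eq324RowRange.uvStability3D_of_inputsEq324CoreLT(_le)`, uniform in the record). [cite: Balaban1985UV3, (41) p.266 (bookkeeping)] -/
theorem runAlphaEq324CoreLT_zero_of_pairs (hle : S.g ^ 2 * S.ε₀ ≤ 1)
    (H : ∀ k, k + 1 ≤ S.K →
      (∀ h' : Hist S.P (k + 1),
          Fibre49 X 𝔠.lane.carrier (zeroRun 𝔊 𝔠) (fun _ => True) k (piecesW 𝔠.lane X (zeroRun 𝔊 𝔠) k) h') ∧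
        Fibre57Low X 𝔠.lane.carrier (zeroRun 𝔊 𝔠) (fun _ => True) k (piecesW 𝔠.lane X (zeroRun 𝔊 𝔠) k))
    (I : RunRowsI 𝔊 𝔠 X (zeroRun 𝔊 𝔠)) :
    ∃ 𝔄 : AlphaDataLT 𝔊 𝔠 X (zeroRun 𝔊 𝔠), RunAlphaEq324CoreLT 𝔊 𝔠 X (zeroRun 𝔊 𝔠) 𝔄 :=
  ⟨zeroAlphaLT 𝔊 𝔠 X hle, (runAlphaEq324CoreLT_zero_iff 𝔊 𝔠 X hle).2 ⟨H, I⟩⟩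

end Zero

end Summit.QuantumFields.YangMills.Theorems.BalabanUVNodesN08AlphaEq324RowRangeZero

end
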